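import Summits.ResolutionOfSingularities.ResolutionOfSingularities.Theorems.SeparableGaloisGaloisQuotientModelsReduction
import Summits.ResolutionOfSingularities.ResolutionOfSingularities.Theorems.PAlterationPicoverBaseCase
import Literature.AlgebraicGeometry.Resolution.ResolutionGlue
import HarnessLib

/-!
# Calibration of the open stub `stub_multiplicativeDefect` (MD) of the line
# `inseparability-foliation-quotient` (crux `GaloisQuotientModels`, stmt-ResolutionOfSingularities-18955)

Route `ResolutionOfSingularities/SeparableGalois`. The line reduces the crux W to two statements,
(MD) = `stub_multiplicativeDefect` and (ELR) = `stub_equivariantLogResolution`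
(`galoisQuotientModels_of_multiplicativeDefect_of_equivariantLogResolution`, landed). This file pins
down the STRENGTH of (MD), scheme by scheme, against the regular separable Galois top
`HasSeparableGaloisTop X` (de Jong's datum with NO inseparable defect — the separable form of
Abramovich–Oort 2000, Question 2.13):

* `multiplicativeDefect_of_hasSeparableGaloisTop` — (MD) for `X` FOLLOWS from a separable Galois top
  of `X`: take it as the datum with exponent `n = 0`; then the Frobenius compositum `M₀` is all of
  `K(X₁)`, so every normal level-`0` sandwich model `u : X₁ → Z` is finite and an isomorphism on
  function fields onto a normal scheme, hence an isomorphism ("finite birational onto normal"), so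
  `Z` is regular and the TRIVIAL log structure is a log regular atlas on which any group acts by log
  automorphisms.
* `hasSeparableGaloisTop_of_multiplicativeDefect_of_equivariantLogResolution` — conversely, for `X`
  whose finite subsets lie in affine opens, (MD) for `X` together with (ELR) GIVES a separable Galois
  top of `X` (this is the body of the landed composition, before the quotient step `stub_quotientModel`).

So, modulo the published theorem (ELR) (Illusie–Temkin 2014, Exp. VIII 3.4.9/3.4.15, in tree as the
named fact `IllusieTemkin2014_equivariantLogRegularResolution`) and Chow's lemma, (MD) is EQUIVALENT,
scheme by scheme, to the existence of a regular separable Galois top — i.e. (MD) is exactly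
crux-strength: it is the separable Galois alteration problem itself, dressed in log clothes. This is
the formal content of the line card's sentence "its type is W-strength modulo the other four stubs".
[cite: DeJong1997, 5.3 and Thm. 5.13] [cite: AbramovichOort2000, Question 2.13]
-/

noncomputable section

-- single-problem summit: the doubled namespace component `ResolutionOfSingularities` is forced
set_option linter.dupNamespace false

open CategoryTheory AlgebraicGeometry TopologicalSpace
open Literature.AlgebraicGeometry.Resolution
open Literature.AlgebraicGeometry.Motives Literature.AlgebraicGeometry.Motives.RatFn
open Summit.ResolutionOfSingularities.ResolutionOfSingularities.Theorems.Picover.BaseCase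
  (isIso_stalkMap_genericPoint_of_bijective isIso_of_isIntegralHom_of_normal)

namespace Summit.ResolutionOfSingularities.ResolutionOfSingularities.Theorems.GaloisQuotientModels

/-- The trivial log structure is preserved by every automorphism: any action of any group on `Z`
is by log automorphisms of `LogAtlas.trivialStructure Z` (all chart values are `1`). [folklore] -/
theorem isLogEquivariant_trivialStructure (Z : Scheme.{0}) {G : Type} [Group G]
    (ρZ : G →* Aut Z) : IsLogEquivariant (LogAtlas.trivialStructure.{0} Z) ρZ := by
  intro g i j z hi hj
  have hc : ∀ (i : (LogAtlas.trivialStructure.{0} Z).ι)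
      (x : Multiplicative ((LogAtlas.trivialStructure.{0} Z).P i)),
      (LogAtlas.trivialStructure.{0} Z).chart i x = 1 := fun _ _ => rfl
  refine ⟨fun q => ⟨q, ?_⟩, fun p' => ⟨p', ?_⟩⟩ <;>
  · rw [hc, hc, map_one, map_one, map_one]

/-- The level-`0` Frobenius compositum is everything: `M₀ = K·L^{p⁰} = L`. [folklore] -/
theorem frobeniusCompositum_zero_eq_top {X₁ X : Scheme.{0}} [IsIntegral X₁] [IsIntegral X]
    (π : X₁ ⟶ X) [IsDominant π] (p : ℕ) : frobeniusCompositum π p 0 = ⊤ := by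
  refine top_unique fun a _ => Subfield.subset_closure (Or.inr ⟨a, ?_⟩)
  simp

/-- A normal sandwich model of level `0` is the top itself: `u : X₁ → Z` is an isomorphism
(finite, an isomorphism on function fields since `u♯ K(Z) = M₀ = K(X₁)`, onto a normal scheme).
[cite: DeJong1996, 4.20–4.21 ("finite birational onto normal is an isomorphism")] -/
theorem isIso_of_isSandwichModel_zero {G : Type} [Group G] {X₁ X Z : Scheme.{0}} [IsIntegral X₁]
    [IsIntegral X] [IsIntegral Z] (p : ℕ) (ρ : G →* Aut X₁) (π : X₁ ⟶ X) [IsDominant π]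
    (ρZ : G →* Aut Z) (u : X₁ ⟶ Z) [IsDominant u] (v : Z ⟶ X)
    (hS : IsSandwichModel p 0 ρ π ρZ u v) : IsIso u := by
  have hsurj : Function.Surjective (functionFieldMap u) := by
    intro a
    have ha : a ∈ (frobeniusCompositum π p 0 : Set X₁.functionField) := by
      rw [frobeniusCompositum_zero_eq_top]
      trivial
    rwa [← hS.range_eq] at ha
  haveI := hS.isFinite
  exact isIso_of_isIntegralHom_of_normal u
    (isIso_stalkMap_genericPoint_of_bijective u ⟨(functionFieldMap u).injective, hsurj⟩)
    hS.isIntegrallyClosed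

/-- **(MD) ⟸ a separable Galois top.** If the integral `X` (locally of finite type over a field)
has a regular separable Galois top (`HasSeparableGaloisTop X`: de Jong's datum with exponent `0`),
then the conclusion of `stub_multiplicativeDefect` holds for `X`, for every `p`: the top is a datum
of exponent `n = 0`, and every normal level-`0` sandwich model is isomorphic to the regular top
(`isIso_of_isSandwichModel_zero`), hence log regular for the trivial log structure, on which `G`
acts by log automorphisms. In particular (MD) is implied, over perfect fields, by the separable
form of Abramovich–Oort's Question 2.13 (and by resolution of singularities: `G = 1`).
[cite: DeJong1997, 5.3 and Thm. 5.13] [cite: AbramovichOort2000, Question 2.13]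
[cite: Kato1994, (2.2)(1)] -/
theorem multiplicativeDefect_of_hasSeparableGaloisTop (p : ℕ) {k : Type} [Field k]
    {X : Scheme.{0}} [IsIntegral X] (f : X ⟶ Spec (.of k)) [LocallyOfFiniteType f]
    (h : HasSeparableGaloisTop X) :
    ∃ (G : Type) (_ : Group G) (_ : Finite G) (X₁ : Scheme.{0}) (_ : IsIntegral X₁)
      (ρ : G →* Aut X₁) (π : X₁ ⟶ X) (_ : IsDominant π) (n : ℕ),
      IsGaloisAlterationOfExponent p n ρ π ∧
      ∀ (Z : Scheme.{0}) [IsIntegral Z] (ρZ : G →* Aut Z) (u : X₁ ⟶ Z) [IsDominant u]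
        (v : Z ⟶ X), IsSandwichModel p n ρ π ρZ u v →
        ∃ 𝒜 : LogAtlas.{0} Z, 𝒜.IsLogRegular ∧ IsLogEquivariant 𝒜 ρZ := by
  obtain ⟨G, _, _, X', _, ρ', π', _, halt, hreg, hinj, hinv, haff, hfield⟩ := h
  refine ⟨G, inferInstance, inferInstance, X', inferInstance, ρ', π', inferInstance, 0,
    ⟨halt, hreg, hinj, hinv, haff, fun a ha => ?_⟩, fun Z _ ρZ u _ v hS => ?_⟩
  · simpa using hfield a ha
  · haveI : IsIso u := isIso_of_isSandwichModel_zero p ρ' π' ρZ u v hS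
    haveI := halt.isProper
    haveI : IsLocallyNoetherian X' := LocallyOfFiniteType.isLocallyNoetherian (π' ≫ f)
    haveI : IsLocallyNoetherian Z := isLocallyNoetherian_of_isOpenImmersion (inv u)
    exact ⟨LogAtlas.trivialStructure.{0} Z,
      (LogAtlas.isLogRegular_trivialStructure_iff Z).2 ⟨inferInstance, hreg.of_iso u⟩,
      isLogEquivariant_trivialStructure Z ρZ⟩

/-- **(MD) ∧ (ELR) ⟹ a separable Galois top**, scheme by scheme: for an integral separated
finite-type `X` over a field of characteristic `p` whose finite subsets lie in affine opens, a de Jong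
datum of exponent `n` all of whose normal level-`n` sandwich models are `G`-equivariantly log regular,
together with equivariant resolution of log regular schemes (ELR, the statement of
`stub_equivariantLogResolution`), yields a regular SEPARABLE Galois top of `X`: the Frobenius
compositum `Mₙ` is `G`-stable with `Mₙ^G = K(X)` (`stub_frobeniusCompositum`), the normal sandwich
model `X₁ → Z → X` exists (`stub_sandwichModel`), it is log regular by hypothesis, (ELR) resolves it
`G`-equivariantly by `r : X' → Z`, and the `G`-fixed rational functions of `X'` come from `K(X)`
(chase through `r♯, u♯, v♯`). This is the body of the landed composition
`galoisQuotientModels_of_multiplicativeDefect_of_equivariantLogResolution` before its last step.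
[cite: DeJong1997, 5.3 and Thm. 5.13] -/
theorem hasSeparableGaloisTop_of_multiplicativeDefect_of_equivariantLogResolution
    (p : ℕ) [Fact p.Prime] (k : Type) [Field k] [CharP k p] (X : Scheme.{0}) [IsIntegral X]
    (f : X ⟶ Spec (.of k)) [IsSeparated f] [LocallyOfFiniteType f] [QuasiCompact f]
    (hXaff : ∀ S : Finset X, ∃ U : X.Opens, IsAffineOpen U ∧ (↑S : Set X) ⊆ U)
    (hMD : ∃ (G : Type) (_ : Group G) (_ : Finite G) (X₁ : Scheme.{0}) (_ : IsIntegral X₁)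
      (ρ : G →* Aut X₁) (π : X₁ ⟶ X) (_ : IsDominant π) (n : ℕ),
      IsGaloisAlterationOfExponent p n ρ π ∧
      ∀ (Z : Scheme.{0}) [IsIntegral Z] (ρZ : G →* Aut Z) (u : X₁ ⟶ Z) [IsDominant u]
      (v : Z ⟶ X), IsSandwichModel p n ρ π ρZ u v →
      ∃ 𝒜 : LogAtlas.{0} Z, 𝒜.IsLogRegular ∧ IsLogEquivariant 𝒜 ρZ)
    (hELR :
      ∀ (Z : Scheme.{0}) [IsIntegral Z] [CompactSpace Z] (𝒜 : LogAtlas.{0} Z) (G : Type)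
      [Group G] [Finite G] (ρZ : G →* Aut Z), 𝒜.IsLogRegular → IsLogEquivariant 𝒜 ρZ →
      (∀ S : Finset Z, ∃ U : Z.Opens, IsAffineOpen U ∧ (↑S : Set Z) ⊆ U) →
      ∃ (X' : Scheme.{0}) (_ : IsIntegral X') (ρ' : G →* Aut X') (r : X' ⟶ Z) (_ : IsDominant r),
      IsProper r ∧ IsBirational r ∧ Scheme.IsRegular X' ∧
      (∀ g : G, (ρ' g).hom ≫ r = r ≫ (ρZ g).hom) ∧
      (∀ S : Finset X', ∃ U : X'.Opens, IsAffineOpen U ∧ (↑S : Set X') ⊆ U) ∧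
      Function.Bijective (functionFieldMap r) ∧
      (Function.Injective ρZ → Function.Injective ρ')) :
    HasSeparableGaloisTop X := by
  obtain ⟨G, _, _, X₁, _, ρ, π, _, n, hGA, hmult⟩ := hMD
  -- characteristic `p` on `K(X₁)` (through `k → Γ(X₁, ⊤) → K(X₁)`)
  haveI : CharP X₁.functionField p := by
    haveI : Nonempty (⊤ : X₁.Opens) := ⟨⟨genericPoint X₁, trivial⟩⟩
    exact (((X₁.germToFunctionField ⊤).hom.comp (((π ≫ f).appTop).hom.comp
      (Scheme.ΓSpecIso (.of k)).inv.hom)).charP_iff_charP p).mp inferInstance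
  -- the Frobenius compositum is `G`-stable with fixed part `K(X)`
  obtain ⟨hstab, hfix⟩ := stub_frobeniusCompositum p n G X₁ X ρ π hGA.comp_eq hGA.pow_mem
  -- the normal sandwich model `X₁ —u→ Z —v→ X`
  obtain ⟨Z, _, ρZ, u, _, v, hSW, hcpt, hv, haffZ, hρZ⟩ :=
    stub_sandwichModel p n k X f hXaff G X₁ ρ π hGA hstab
  -- `Z` is log regular, `G` acts by log automorphisms
  obtain ⟨𝒜, h𝒜, heqv⟩ := hmult Z ρZ u v hSW
  -- equivariant resolution `r : X' → Z`
  haveI := hcpt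
  obtain ⟨X', _, ρ', r, _, hr, hbir, hreg, hcomm, haffX', hbij, hinj⟩ := hELR Z 𝒜 G ρZ h𝒜 heqv haffZ
  haveI := hr
  haveI := hv.isProper
  haveI := hv.isDominant
  -- the separable Galois top `π' := r ≫ v`
  have halt : IsAlteration (r ≫ v) := (hbir.isAlteration).comp hv
  have hinv' : ∀ g : G, (ρ' g).hom ≫ (r ≫ v) = r ≫ v := fun g => by
    rw [← Category.assoc, hcomm g, Category.assoc, hSW.inv g]
  have key : ∀ {A B : Scheme.{0}} [IsIntegral A] [IsIntegral B] (φ ψ : A ⟶ B) [IsDominant φ]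
      [IsDominant ψ], φ = ψ → functionFieldMap φ = functionFieldMap ψ := by
    intro A B _ _ φ ψ _ _ e
    subst e
    rfl
  have hfield : ∀ a : X'.functionField, (∀ g : G, functionFieldMap (ρ' g).hom a = a) →
      a ∈ Set.range (functionFieldMap (r ≫ v)) := by
    intro a ha
    obtain ⟨b, rfl⟩ := hbij.2 a
    -- `b ∈ K(Z)` is fixed by `ρZ`
    have hb : ∀ g : G, functionFieldMap (ρZ g).hom b = b := by
      intro g
      apply hbij.1
      have e₂ := congrArg (fun φ => φ b) (key _ _ (hcomm g))
      simp only [functionFieldMap_comp, RingHom.comp_apply] at e₂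
      rw [ha g] at e₂
      exact e₂.symm
    -- `u♯ b ∈ Mₙ` is fixed by `ρ`, hence comes from `K(X)`
    have hub : ∀ g : G, functionFieldMap (ρ g).hom (functionFieldMap u b) =
        functionFieldMap u b := by
      intro g
      have e₂ := congrArg (fun φ => φ b) (key _ _ (hSW.comm g))
      simp only [functionFieldMap_comp, RingHom.comp_apply] at e₂
      rw [hb g] at e₂
      exact e₂
    have hmem : functionFieldMap u b ∈ frobeniusCompositum π p n := by
      have : functionFieldMap u b ∈ Set.range (functionFieldMap u) := ⟨b, rfl⟩
      rw [hSW.range_eq] at this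
      exact this
    obtain ⟨d, hd⟩ := hfix _ hmem hub
    rw [key _ _ hSW.fac.symm, functionFieldMap_comp, RingHom.comp_apply] at hd
    have hbd : b = functionFieldMap v d := (functionFieldMap u).injective hd.symm
    refine ⟨d, ?_⟩
    rw [functionFieldMap_comp, RingHom.comp_apply, ← hbd]
  exact ⟨G, inferInstance, inferInstance, X', inferInstance, ρ', r ≫ v, inferInstance, halt, hreg,
    hinj hρZ, hinv', haffX', hfield⟩

/-- **W from separable Galois tops** (the true core of the route, isolated): if every integral
separated finite-type scheme over a perfect field whose finite subsets lie in affine opens has a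
regular SEPARABLE Galois top (`HasSeparableGaloisTop`, de Jong's datum with no inseparable defect —
the separable form of Abramovich–Oort 2000, Question 2.13), then the crux `GaloisQuotientModels` (W)
holds: Chow (`exists_isBirational_finsetsInAffineOpens`) replaces `X` by a quasi-projective proper
birational model, the landed `stub_quotientModel` turns the top into the Galois-quotient model, and
the proper birational maps compose. Together with `multiplicativeDefect_of_hasSeparableGaloisTop` this
brackets the open stub (MD) between the hypothesis here and W. [cite: DeJong1997, 5.3 and Cor. 5.15]
[cite: AbramovichOort2000, Question 2.13] -/
theorem galoisQuotientModels_of_forall_hasSeparableGaloisTop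
    (h : ∀ (k : Type) [Field k] [PerfectField k] (X : Scheme.{0}) [IsIntegral X]
      (f : X ⟶ Spec (.of k)) [IsSeparated f] [LocallyOfFiniteType f] [QuasiCompact f],
      (∀ S : Finset X, ∃ U : X.Opens, IsAffineOpen U ∧ (↑S : Set X) ⊆ U) →
      HasSeparableGaloisTop X) :
    Summit.ResolutionOfSingularities.ResolutionOfSingularities.Theses.SeparableGalois.GaloisQuotientModels := by
  intro p _ k _ _ _ X₀ f₀ hs₀ hl₀ hq₀ hi₀
  haveI := hs₀; haveI := hl₀; haveI := hq₀; haveI := hi₀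
  -- Chow: a quasi-projective proper birational model `π₀ : X → X₀`
  obtain ⟨X, hiX, π₀, hπ₀, hb₀, hXaff⟩ := exists_isBirational_finsetsInAffineOpens X₀ f₀
  haveI := hiX; haveI := hπ₀
  let f : X ⟶ Spec (.of k) := π₀ ≫ f₀
  haveI : IsSeparated f := inferInstanceAs (IsSeparated (π₀ ≫ f₀))
  haveI : LocallyOfFiniteType f := inferInstanceAs (LocallyOfFiniteType (π₀ ≫ f₀))
  haveI : QuasiCompact f := inferInstanceAs (QuasiCompact (π₀ ≫ f₀))
  -- the Galois-quotient model of `X` (landed stub 5), pushed down to `X₀`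
  obtain ⟨X₁, X', π, q, G, _, _, ρ, hπ, hbir, h1, h2, hreg, hfin, hsurj, het, hinv, horb⟩ :=
    stub_quotientModel k X f (h k X f hXaff)
  haveI := hπ
  exact ⟨X₁, X', π ≫ π₀, q, G, inferInstance, inferInstance, ρ, inferInstance, hbir.comp hb₀, h1,
    h2, hreg, hfin, hsurj, het, hinv, horb⟩

end Summit.ResolutionOfSingularities.ResolutionOfSingularities.Theorems.GaloisQuotientModels

end
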